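import Literature.Probability.Process.BrownianRunningSup
import Literature.Probability.Process.NestedStoppedMartingales
import HarnessLib

/-!
# Brownian increments after a fixed time: the running supremum on `[u, u + h]`, moments and tail

Trunk T-PROBABILITY (Literature/Probability/Process). The estimates of `BrownianSupTail` /
`BrownianRunningSup` (running maximum of the canonical Brownian motion on `[0, h]`: an `L²`
bound by Doob's inequality and an `O(h²)` tail by Doob's inequality for `B_t² - t`) restated for
the INCREMENTS after an arbitrary time `u`, i.e. for `v ↦ B_{u+v} - B_u` on `[0, h]` — the form
consumed by one-step (conditional increment) estimates at time `u`:

* `Literature.Probability.Process.martingale_incr` — `v ↦ B_{u+v} - B_u` is a martingale for the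
  shifted filtration `𝓕ᵂ(u + ·)` (`Filtration.addLeft`), and
  `Literature.Probability.Process.martingale_sqIncr_shift` — so is `v ↦ (B_{u+v} - B_u)² - v`
  (conditional centring of squared increments, `condExp_sqIncr`, and the pull-out property);
* `Literature.Probability.Process.incRunSup u h ω = sup_{v ∈ [0,h] dyadic} |B_{u+v} - B_u|`, which
  dominates `|B_{u+v} - B_u|` for all `v ≤ h` (continuous paths), is measurable, with
  **`E[(incRunSup u h)²] ≤ 4h`** (`integral_incRunSup_sq_le`, Doob's `L²` inequality for the
  increments, `Martingale.lintegral_iSup_sq_sub_le`), `E[incRunSup u h] ≤ 2√h`, and the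
  **`O(h²)` tail `P(incRunSup u h ≥ a) ≤ 2h²/((a/2)² - h)²`** (`measure_incRunSup_ge_le`).

## References

* D. Revuz, M. Yor, *Continuous Martingales and Brownian Motion* (1999), Ch. II, Prop. (1.2),
  Thm (1.7). [RevuzYor1999]
-/

noncomputable section

open MeasureTheory Filter Set
open scoped NNReal ENNReal Topology

namespace Literature.Probability.Process

open RandomPlanarGeometry (brownianFiltration)

/-! ### The increment martingales after time `u` -/

/-- **`v ↦ B_{u+v} - B_u` is a martingale** for the shifted filtration `𝓕ᵂ(u + ·)`.
[cite: RevuzYor1999, Ch. II Prop. (1.2)(i)] -/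
theorem martingale_incr (u : ℝ≥0) :
    Martingale (fun v ω ↦ brownian (u + v) ω - brownian u ω) (brownianFiltration.addLeft u) preWienerMeasure := by
  haveI := RandomPlanarGeometry.isProbabilityMeasure_preWienerMeasure'
  exact RandomPlanarGeometry.martingale_brownian_holds.shift_sub u

/-- **`v ↦ (B_{u+v} - B_u)² - v` is a martingale** for the shifted filtration `𝓕ᵂ(u + ·)`:
with `C = B_{u+v} - B_u` (`𝓕ᵂ_{u+v}`-measurable) and `D = B_{u+v'} - B_{u+v}`,
`E[(C + D)² - v' | 𝓕ᵂ_{u+v}] = C² - v + 2 C E[D | ·] + E[D² - (v' - v) | ·] = C² - v`.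
[cite: RevuzYor1999, Ch. II Prop. (1.2)(ii)] -/
theorem martingale_sqIncr_shift (u : ℝ≥0) :
    Martingale (fun v ω ↦ (brownian (u + v) ω - brownian u ω) ^ 2 - (v : ℝ))
      (brownianFiltration.addLeft u) preWienerMeasure := by
  haveI := RandomPlanarGeometry.isProbabilityMeasure_preWienerMeasure'
  have hN := martingale_incr u
  refine ⟨fun v ↦ ((hN.stronglyAdapted v).pow 2).sub stronglyMeasurable_const, fun v v' hvv' ↦ ?_⟩
  -- notation
  set C : (ℝ≥0 → ℝ) → ℝ := fun ω ↦ brownian (u + v) ω - brownian u ω with hC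
  set D : (ℝ≥0 → ℝ) → ℝ := fun ω ↦ brownian (u + v') ω - brownian (u + v) ω with hD
  have huv : u + v ≤ u + v' := add_le_add le_rfl hvv'
  have hCm : StronglyMeasurable[brownianFiltration (u + v)] C := hN.stronglyAdapted v
  have hC2 : MemLp C 2 preWienerMeasure := RandomPlanarGeometry.memLp_two_brownian_sub u (u + v)
  have hD2 : MemLp D 2 preWienerMeasure := RandomPlanarGeometry.memLp_two_brownian_sub (u + v) (u + v')
  have hCD : Integrable (fun ω ↦ C ω * D ω) preWienerMeasure := hC2.integrable_mul hD2
  have hDint : Integrable D preWienerMeasure := hD2.integrable one_le_two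
  have hC2int : Integrable (fun ω ↦ C ω ^ 2) preWienerMeasure := hC2.integrable_sq
  have hD2int : Integrable (fun ω ↦ D ω ^ 2 - ((v' : ℝ) - v)) preWienerMeasure := by
    have := integrable_sqIncr (u + v) (u + v')
    refine this.congr (Eventually.of_forall fun ω ↦ ?_)
    simp only [hD, Pi.sub_apply]
    push_cast
    ring
  -- the three conditional expectations
  have h1 : preWienerMeasure[fun ω ↦ D ω ^ 2 - ((v' : ℝ) - v) | brownianFiltration (u + v)]
      =ᵐ[preWienerMeasure] 0 := by
    have := condExp_sqIncr (s := u + v) (u := u + v') huv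
    refine (condExp_congr_ae (Eventually.of_forall fun ω ↦ ?_)).trans this
    simp only [hD, Pi.sub_apply]
    push_cast
    ring
  have h2 : preWienerMeasure[fun ω ↦ C ω * D ω | brownianFiltration (u + v)] =ᵐ[preWienerMeasure] 0 := by
    have hpull := condExp_mul_of_stronglyMeasurable_left (m := brownianFiltration (u + v)) hCm hCD hDint
      (μ := preWienerMeasure)
    have hD0 : preWienerMeasure[D | brownianFiltration (u + v)] =ᵐ[preWienerMeasure] 0 :=
      RandomPlanarGeometry.condExp_brownian_sub huv
    filter_upwards [hpull, hD0] with ω hω hω'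
    rw [show (fun ω ↦ C ω * D ω) = C * D from rfl, hω, Pi.mul_apply, hω', Pi.zero_apply, mul_zero]
  have h3 : preWienerMeasure[fun ω ↦ C ω ^ 2 - (v : ℝ) | brownianFiltration (u + v)] =
      fun ω ↦ C ω ^ 2 - (v : ℝ) :=
    condExp_of_stronglyMeasurable (brownianFiltration.le _) ((hCm.pow 2).sub stronglyMeasurable_const)
      (hC2int.sub (integrable_const _))
  -- assemble
  have hdec : (fun ω ↦ (brownian (u + v') ω - brownian u ω) ^ 2 - (v' : ℝ)) =
      (fun ω ↦ C ω ^ 2 - (v : ℝ)) + (fun ω ↦ 2 * (C ω * D ω)) + (fun ω ↦ D ω ^ 2 - ((v' : ℝ) - v)) := by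
    ext ω
    simp only [hC, hD, Pi.add_apply]
    ring
  change preWienerMeasure[(fun ω ↦ (brownian (u + v') ω - brownian u ω) ^ 2 - (v' : ℝ)) |
    brownianFiltration (u + v)] =ᵐ[preWienerMeasure] fun ω ↦ (brownian (u + v) ω - brownian u ω) ^ 2 - (v : ℝ)
  rw [hdec]
  have hi1 : Integrable (fun ω ↦ C ω ^ 2 - (v : ℝ)) preWienerMeasure := hC2int.sub (integrable_const _)
  have hi2 : Integrable (fun ω ↦ 2 * (C ω * D ω)) preWienerMeasure := hCD.const_mul 2
  have ha := condExp_add (hi1.add hi2) hD2int (brownianFiltration (u + v)) (μ := preWienerMeasure)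
  have hb := condExp_add hi1 hi2 (brownianFiltration (u + v)) (μ := preWienerMeasure)
  have hc : preWienerMeasure[fun ω ↦ 2 * (C ω * D ω) | brownianFiltration (u + v)] =ᵐ[preWienerMeasure]
      fun ω ↦ 2 * (preWienerMeasure[fun ω ↦ C ω * D ω | brownianFiltration (u + v)]) ω := by
    have := condExp_smul (2 : ℝ) (fun ω ↦ C ω * D ω) (brownianFiltration (u + v)) (μ := preWienerMeasure)
    simp only [Pi.smul_def, smul_eq_mul] at this ⊢
    exact this
  filter_upwards [ha, hb, hc, h1, h2] with ω hωa hωb hωc hω1 hω2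
  rw [hωa, Pi.add_apply, hωb, Pi.add_apply, hωc, hω2, hω1, h3]
  simp only [Pi.zero_apply, mul_zero, add_zero, hC]

/-- `E[((B_{u+h} - B_u)² - h)²] = 2h²`. [folklore] -/
theorem integral_sqIncr_shift_sq (u h : ℝ≥0) :
    ∫ ω, ((brownian (u + h) ω - brownian u ω) ^ 2 - (h : ℝ)) ^ 2 ∂preWienerMeasure = 2 * (h : ℝ) ^ 2 := by
  have := integral_sqIncr_sq (s := u) (u := u + h) le_self_add
  simp only [Pi.sub_apply, NNReal.coe_add, add_sub_cancel_left] at this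
  exact this

/-! ### The running supremum of the increments -/

/-- **The running supremum of the increments** `|B_{u+v} - B_u|`, `v ∈ [0, h]`, along the
countable dyadic grid of `[0, h]` (equal to the supremum over `[0, h]` on continuous paths, cf.
`abs_incr_le_incRunSup`). [folklore] -/
def incRunSup (u h : ℝ≥0) (ω : ℝ≥0 → ℝ) : ℝ :=
  ⨆ p : ℕ × ℕ, |brownian (u + dyadTime h p.1 p.2) ω - brownian u ω|

/-- The family is bounded above (continuous path). [folklore] -/
theorem bddAbove_range_abs_incr_dyad (u h : ℝ≥0) (ω : ℝ≥0 → ℝ) :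
    BddAbove (Set.range fun p : ℕ × ℕ ↦ |brownian (u + dyadTime h p.1 p.2) ω - brownian u ω|) := by
  obtain ⟨C, hC⟩ := isCompact_Icc.exists_bound_of_continuousOn (s := Set.Icc (0 : ℝ≥0) h)
    ((((continuous_brownian ω).comp (continuous_const.add continuous_id)).sub continuous_const).continuousOn)
  refine ⟨C, ?_⟩
  rintro _ ⟨p, rfl⟩
  have := hC (dyadTime h p.1 p.2) ⟨bot_le, dyadTime_le h p.1 p.2⟩
  rwa [Real.norm_eq_abs] at this

/-- `incRunSup` is measurable. [folklore] -/
theorem measurable_incRunSup' (u h : ℝ≥0) : Measurable (incRunSup u h) :=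
  Measurable.iSup fun _ ↦ ((measurable_brownian _).sub (measurable_brownian _)).abs

/-- `0 ≤ incRunSup`. [folklore] -/
theorem incRunSup_nonneg (u h : ℝ≥0) (ω : ℝ≥0 → ℝ) : 0 ≤ incRunSup u h ω := by
  refine le_ciSup_of_le (bddAbove_range_abs_incr_dyad u h ω) (0, 0) ?_
  exact abs_nonneg _

/-- Grid values are dominated by `incRunSup`. [folklore] -/
theorem abs_incr_dyad_le_incRunSup (u h : ℝ≥0) (ω : ℝ≥0 → ℝ) (n k : ℕ) :
    |brownian (u + dyadTime h n k) ω - brownian u ω| ≤ incRunSup u h ω :=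
  le_ciSup (bddAbove_range_abs_incr_dyad u h ω) (n, k)

/-- **`|B_{u+v} - B_u| ≤ incRunSup u h` for all `v ≤ h`** (continuity of the path and density of
the dyadic grid). [folklore] -/
theorem abs_incr_le_incRunSup {u h v : ℝ≥0} (hv : v ≤ h) (ω : ℝ≥0 → ℝ) :
    |brownian (u + v) ω - brownian u ω| ≤ incRunSup u h ω := by
  -- transfer `abs_brownian_le_runSup`'s grid approximation through the shifted path
  set f : ℝ≥0 → ℝ := fun s ↦ brownian (u + s) ω - brownian u ω with hf
  have hfc : Continuous f := ((continuous_brownian ω).comp (continuous_const.add continuous_id)).sub continuous_const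
  have hgrid : ∀ n k, |f (dyadTime h n k)| ≤ incRunSup u h ω := fun n k ↦ abs_incr_dyad_le_incRunSup u h ω n k
  rcases eq_or_ne h 0 with rfl | h0
  · have : v = 0 := le_antisymm hv bot_le
    subst this
    have := hgrid 0 0
    simp only [dyadTime, Nat.cast_zero, zero_div, mul_zero] at this
    simpa [hf] using this
  have hpos : (0 : ℝ) < h := lt_of_le_of_ne h.coe_nonneg (fun h' ↦ h0 (by exact_mod_cast h'.symm))
  set k : ℕ → ℕ := fun n ↦ ⌊(v : ℝ) / h * 2 ^ n⌋₊ with hk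
  have hbounds : ∀ n, (dyadTime h n (k n) : ℝ) ≤ v ∧ (v : ℝ) - h / 2 ^ n ≤ dyadTime h n (k n) := by
    intro n
    have hfl := Nat.floor_le (by positivity : (0 : ℝ) ≤ (v : ℝ) / h * 2 ^ n)
    have hfl' : (v : ℝ) / h * 2 ^ n < k n + 1 := Nat.lt_floor_add_one _
    have hval : ((h * ((k n : ℝ≥0) / 2 ^ n) : ℝ≥0) : ℝ) = h * (k n : ℝ) / 2 ^ n := by push_cast; ring
    have hle : ((h * ((k n : ℝ≥0) / 2 ^ n) : ℝ≥0) : ℝ) ≤ v := by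
      rw [hval, div_le_iff₀ (by positivity)]
      calc (h : ℝ) * (k n) ≤ h * ((v : ℝ) / h * 2 ^ n) := mul_le_mul_of_nonneg_left hfl h.coe_nonneg
        _ = v * 2 ^ n := by field_simp
    have hmin : dyadTime h n (k n) = h * ((k n : ℝ≥0) / 2 ^ n) := by
      rw [dyadTime, min_eq_left]
      exact_mod_cast hle.trans (by exact_mod_cast hv : (v : ℝ) ≤ h)
    refine ⟨by rw [hmin]; exact hle, ?_⟩
    rw [hmin, hval, le_div_iff₀ (by positivity)]
    rw [div_mul_eq_mul_div, div_lt_iff₀ hpos] at hfl'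
    have h2n : (0 : ℝ) < 2 ^ n := by positivity
    have : ((v : ℝ) - h / 2 ^ n) * 2 ^ n = v * 2 ^ n - h := by field_simp
    rw [this]
    nlinarith
  have hconv : Tendsto (fun n ↦ (dyadTime h n (k n) : ℝ)) atTop (𝓝 v) := by
    refine tendsto_of_tendsto_of_tendsto_of_le_of_le ?_ tendsto_const_nhds (fun n ↦ (hbounds n).2)
      (fun n ↦ (hbounds n).1)
    have h1 : Tendsto (fun n : ℕ ↦ (h : ℝ) / 2 ^ n) atTop (𝓝 0) := by
      have := (tendsto_pow_atTop_nhds_zero_of_lt_one (r := (1 / 2 : ℝ)) (by norm_num) (by norm_num)).const_mul (h : ℝ)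
      rw [mul_zero] at this
      refine this.congr fun n ↦ ?_
      rw [one_div, inv_pow, div_eq_mul_inv]
    simpa using tendsto_const_nhds.sub h1
  have hconv' : Tendsto (fun n ↦ dyadTime h n (k n)) atTop (𝓝 v) := NNReal.tendsto_coe.1 hconv
  have hcont : Tendsto (fun n ↦ |f (dyadTime h n (k n))|) atTop (𝓝 |f v|) :=
    ((hfc.tendsto v).comp hconv').abs
  exact le_of_tendsto' hcont fun n ↦ hgrid n (k n)

/-- Pointwise: `ofReal (incRunSup² ω) ≤ ⨆_{r ∈ [u, u+h]} ofReal ((B_r ω - B_u ω)²)` (grid points lie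
in `[u, u + h]`). [folklore] -/
theorem ofReal_incRunSup_sq_le (u h : ℝ≥0) (ω : ℝ≥0 → ℝ) :
    ENNReal.ofReal (incRunSup u h ω ^ 2) ≤
      ⨆ r ∈ Set.Icc u (u + h), ENNReal.ofReal ((brownian r ω - brownian u ω) ^ 2) := by
  have hbdd := bddAbove_range_abs_incr_dyad u h ω
  set F : ℝ → ℝ≥0∞ := fun x ↦ ENNReal.ofReal (max x 0 ^ 2) with hF
  have hFmono : Monotone F := fun x y hxy ↦ by
    simp only [hF]
    exact ENNReal.ofReal_le_ofReal (pow_le_pow_left₀ (le_max_right _ _) (max_le_max hxy le_rfl) 2)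
  have hFcont : Continuous F := ENNReal.continuous_ofReal.comp ((continuous_id.max continuous_const).pow 2)
  have h1 := Monotone.map_ciSup_of_continuousAt (f := F) hFcont.continuousAt hFmono hbdd
  have hFrun : F (incRunSup u h ω) = ENNReal.ofReal (incRunSup u h ω ^ 2) := by
    simp only [hF, max_eq_left (incRunSup_nonneg u h ω)]
  rw [← hFrun, incRunSup, h1]
  refine iSup_le fun p ↦ ?_
  have hrw : F |brownian (u + dyadTime h p.1 p.2) ω - brownian u ω| =
      ENNReal.ofReal ((brownian (u + dyadTime h p.1 p.2) ω - brownian u ω) ^ 2) := by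
    simp only [hF]
    rw [max_eq_left (abs_nonneg _), sq_abs]
  rw [hrw]
  exact le_iSup₂_of_le (f := fun r (_ : r ∈ Set.Icc u (u + h)) ↦ ENNReal.ofReal ((brownian r ω - brownian u ω) ^ 2))
    (u + dyadTime h p.1 p.2) (show u + dyadTime h p.1 p.2 ∈ Set.Icc u (u + h) from
      ⟨le_self_add, add_le_add le_rfl (dyadTime_le h p.1 p.2)⟩) le_rfl

/-- **`∫⁻ (incRunSup u h)² ≤ 4h`** (Doob's `L²` inequality for the increments after `u`,
`Martingale.lintegral_iSup_sq_sub_le`). [cite: RevuzYor1999, Ch. II Thm (1.7)] -/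
theorem lintegral_incRunSup_sq_le (u h : ℝ≥0) :
    ∫⁻ ω, ENNReal.ofReal (incRunSup u h ω ^ 2) ∂preWienerMeasure ≤ 4 * ENNReal.ofReal h := by
  haveI := RandomPlanarGeometry.isProbabilityMeasure_preWienerMeasure'
  have hD := RandomPlanarGeometry.martingale_brownian_holds.lintegral_iSup_sq_sub_le
    RandomPlanarGeometry.memLp_two_brownian (Eventually.of_forall continuous_brownian) (s := u) (t := u + h)
    le_self_add
  have hB2 : ∫⁻ ω, ENNReal.ofReal ((brownian (u + h) ω - brownian u ω) ^ 2) ∂preWienerMeasure = ENNReal.ofReal h := by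
    have hint : Integrable (fun ω ↦ (brownian (u + h) ω - brownian u ω) ^ 2) preWienerMeasure :=
      (RandomPlanarGeometry.memLp_two_brownian_sub u (u + h)).integrable_sq
    rw [← ofReal_integral_eq_lintegral_ofReal hint (Eventually.of_forall fun ω ↦ sq_nonneg _)]
    have := RandomPlanarGeometry.integral_brownian_sub_sq (s := u) (t := u + h) le_self_add
    simp only [Pi.sub_apply, NNReal.coe_add, add_sub_cancel_left] at this
    rw [this]
  calc ∫⁻ ω, ENNReal.ofReal (incRunSup u h ω ^ 2) ∂preWienerMeasure
      ≤ ∫⁻ ω, ⨆ r ∈ Set.Icc u (u + h), ENNReal.ofReal ((brownian r ω - brownian u ω) ^ 2) ∂preWienerMeasure :=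
        lintegral_mono fun ω ↦ ofReal_incRunSup_sq_le u h ω
    _ ≤ 4 * ∫⁻ ω, ENNReal.ofReal ((brownian (u + h) ω - brownian u ω) ^ 2) ∂preWienerMeasure := hD
    _ = 4 * ENNReal.ofReal h := by rw [hB2]

/-- `(incRunSup u h)²` is integrable. [folklore] -/
theorem integrable_incRunSup_sq (u h : ℝ≥0) : Integrable (fun ω ↦ incRunSup u h ω ^ 2) preWienerMeasure := by
  refine ⟨((measurable_incRunSup' u h).pow_const 2).aestronglyMeasurable, ?_⟩
  have hfin : ∫⁻ ω, ENNReal.ofReal (incRunSup u h ω ^ 2) ∂preWienerMeasure < ∞ :=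
    lt_of_le_of_lt (lintegral_incRunSup_sq_le u h) (ENNReal.mul_lt_top ENNReal.ofNat_lt_top ENNReal.ofReal_lt_top)
  refine lt_of_le_of_lt (le_of_eq (lintegral_congr fun ω ↦ ?_)) hfin
  exact Real.enorm_eq_ofReal (sq_nonneg _)

/-- **`E[(incRunSup u h)²] ≤ 4h`.** [cite: RevuzYor1999, Ch. II Thm (1.7)] -/
theorem integral_incRunSup_sq_le (u h : ℝ≥0) : ∫ ω, incRunSup u h ω ^ 2 ∂preWienerMeasure ≤ 4 * (h : ℝ) := by
  have hlin := lintegral_incRunSup_sq_le u h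
  rw [integral_eq_lintegral_of_nonneg_ae (Eventually.of_forall fun ω ↦ sq_nonneg _)
    ((measurable_incRunSup' u h).pow_const 2).aestronglyMeasurable]
  have := ENNReal.toReal_mono (by simp [ENNReal.mul_ne_top] : 4 * ENNReal.ofReal (h : ℝ) ≠ ∞) hlin
  rwa [ENNReal.toReal_mul, ENNReal.toReal_ofReal h.coe_nonneg, ENNReal.toReal_ofNat] at this

/-- `incRunSup u h` is square integrable. [folklore] -/
theorem memLp_two_incRunSup (u h : ℝ≥0) : MemLp (incRunSup u h) 2 preWienerMeasure :=
  (memLp_two_iff_integrable_sq (measurable_incRunSup' u h).aestronglyMeasurable).2 (integrable_incRunSup_sq u h)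

/-- `incRunSup u h` is integrable. [folklore] -/
theorem integrable_incRunSup (u h : ℝ≥0) : Integrable (incRunSup u h) preWienerMeasure := by
  haveI := RandomPlanarGeometry.isProbabilityMeasure_preWienerMeasure'
  exact (memLp_two_incRunSup u h).integrable one_le_two

/-- **`E[incRunSup u h] ≤ 2 √h`** (`E[X]² ≤ E[X²]`). [cite: RevuzYor1999, Ch. II Thm (1.7)] -/
theorem integral_incRunSup_le (u h : ℝ≥0) : ∫ ω, incRunSup u h ω ∂preWienerMeasure ≤ 2 * Real.sqrt h := by
  haveI := RandomPlanarGeometry.isProbabilityMeasure_preWienerMeasure'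
  -- `(∫ f)² ≤ ∫ f²`: `0 ≤ ∫ (f - c)² = ∫ f² - c²` with `c = ∫ f`
  set c : ℝ := ∫ ω, incRunSup u h ω ∂preWienerMeasure with hc
  have hf := integrable_incRunSup u h
  have hf2 := integrable_incRunSup_sq u h
  have h1 : c ^ 2 ≤ ∫ ω, incRunSup u h ω ^ 2 ∂preWienerMeasure := by
    have h0 : 0 ≤ ∫ ω, (incRunSup u h ω - c) ^ 2 ∂preWienerMeasure := integral_nonneg fun ω ↦ sq_nonneg _
    have hexp : ∫ ω, (incRunSup u h ω - c) ^ 2 ∂preWienerMeasure =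
        ∫ ω, (incRunSup u h ω ^ 2 - 2 * c * incRunSup u h ω + c ^ 2) ∂preWienerMeasure := by
      congr 1 with ω; ring
    have hi1 : Integrable (fun ω ↦ incRunSup u h ω ^ 2 - 2 * c * incRunSup u h ω) preWienerMeasure :=
      hf2.sub (hf.const_mul _)
    rw [hexp, integral_add hi1 (integrable_const _), integral_sub hf2 (hf.const_mul _), integral_const_mul,
      integral_const, smul_eq_mul, probReal_univ, one_mul, ← hc] at h0
    nlinarith
  have h0 : 0 ≤ ∫ ω, incRunSup u h ω ∂preWienerMeasure := integral_nonneg fun ω ↦ incRunSup_nonneg u h ω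
  have h3 : (∫ ω, incRunSup u h ω ∂preWienerMeasure) ^ 2 ≤ (2 * Real.sqrt h) ^ 2 := by
    rw [mul_pow, Real.sq_sqrt h.coe_nonneg]; linarith [integral_incRunSup_sq_le u h]
  exact (pow_le_pow_iff_left₀ h0 (by positivity) two_ne_zero).1 h3

/-- **`O(h²)` tail of the running supremum of the increments**:
`P(incRunSup u h ≥ a) ≤ 2h²/((a/2)² - h)²` for `a ≥ 0`, `(a/2)² > h` (if `incRunSup ≥ a` some grid
point has `|B_{u+v} - B_u| ≥ a/2`; Doob's maximal inequality for the martingale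
`(B_{u+v} - B_u)² - v`, whose value at `h` has second moment `2h²`).
[cite: RevuzYor1999, Ch. II Thm (1.7)] -/
theorem measure_incRunSup_ge_le (u h : ℝ≥0) {a : ℝ} (ha0 : 0 ≤ a) (ha : (h : ℝ) < (a / 2) ^ 2) :
    preWienerMeasure {ω | a ≤ incRunSup u h ω} ≤ ENNReal.ofReal (2 * (h : ℝ) ^ 2 / ((a / 2) ^ 2 - h) ^ 2) := by
  haveI := RandomPlanarGeometry.isProbabilityMeasure_preWienerMeasure'
  have hapos : 0 < a := lt_of_le_of_ne ha0 (by
    rintro rfl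
    have : (0 : ℝ) ≤ h := h.coe_nonneg
    nlinarith)
  -- Doob for `M_v = (B_{u+v} - B_u)² - v`
  set M : ℝ≥0 → (ℝ≥0 → ℝ) → ℝ := fun v ω ↦ (brownian (u + v) ω - brownian u ω) ^ 2 - (v : ℝ) with hM
  have hmart : Martingale M (brownianFiltration.addLeft u) preWienerMeasure := martingale_sqIncr_shift u
  have hL2 : ∀ v, MemLp (M v) 2 preWienerMeasure := fun v ↦
    (memLp_two_brownian_sub_sq u (u + v)).sub (memLp_const _)
  have hcont : ∀ᵐ ω ∂preWienerMeasure, Continuous fun v ↦ M v ω :=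
    Eventually.of_forall fun ω ↦ ((((continuous_brownian ω).comp (continuous_const.add continuous_id)).sub
      continuous_const).pow 2).sub NNReal.continuous_coe
  have hε : 0 < (a / 2) ^ 2 - h := sub_pos.2 ha
  have hD := doob_sq_maximal_ineq_of_continuous hmart hL2 hcont hε h
  -- `{a ≤ incRunSup} ⊆ {∃ v ≤ h, a/2 ≤ |B_{u+v} - B_u|} ⊆ {∃ v ≤ h, (a/2)² - h ≤ |M_v|}`
  have hsub : {ω | a ≤ incRunSup u h ω} ⊆ {ω | ∃ v ≤ h, (a / 2) ^ 2 - h ≤ |M v ω|} := by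
    intro ω hω
    have hω' : a ≤ incRunSup u h ω := hω
    obtain ⟨p, hp⟩ : ∃ p : ℕ × ℕ, a / 2 ≤ |brownian (u + dyadTime h p.1 p.2) ω - brownian u ω| := by
      by_contra hnot
      push Not at hnot
      have : incRunSup u h ω ≤ a / 2 := ciSup_le fun p ↦ (hnot p).le
      linarith
    refine ⟨dyadTime h p.1 p.2, dyadTime_le h p.1 p.2, ?_⟩
    have h1 : (a / 2) ^ 2 ≤ (brownian (u + dyadTime h p.1 p.2) ω - brownian u ω) ^ 2 := by
      nlinarith [abs_nonneg (brownian (u + dyadTime h p.1 p.2) ω - brownian u ω),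
        sq_abs (brownian (u + dyadTime h p.1 p.2) ω - brownian u ω)]
    have h2 : (dyadTime h p.1 p.2 : ℝ) ≤ h := by exact_mod_cast dyadTime_le h p.1 p.2
    simp only [hM]
    exact le_trans (by linarith) (le_abs_self _)
  refine (measure_mono hsub).trans (hD.trans (le_of_eq ?_))
  rw [integral_sqIncr_shift_sq]

end Literature.Probability.Process

end
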